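import Summits.FinalStateConjecture.Statement
import HarnessLib
import Summits.FinalStateConjecture.FinalStateConjecture.Theorems.EIHFluxBalanceInertialRecessionStubPseudotensorBound
import Summits.FinalStateConjecture.FinalStateConjecture.Theorems.EIHFluxBalanceInertialRecessionStubChargeModelWindowLawMain
import Summits.FinalStateConjecture.FinalStateConjecture.Theorems.EIHFluxBalanceInertialRecessionStubEndgameOracleTop
import Summits.FinalStateConjecture.FinalStateConjecture.Theorems.EIHFluxBalanceInertialRecessionStubIdentificationMain
import Summits.FinalStateConjecture.FinalStateConjecture.Theorems.EIHFluxBalanceInertialRecessionStubCleanExcision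
import Summits.FinalStateConjecture.FinalStateConjecture.Theorems.EIHFluxBalanceInertialRecessionStubOracleOfClusterBalance
import Summits.FinalStateConjecture.FinalStateConjecture.Theorems.EIHFluxBalanceInertialRecessionStubNoHolesOnRegion
import Summits.FinalStateConjecture.FinalStateConjecture.Theorems.EIHFluxBalanceInertialRecessionStubRechart12OnRegion
import Summits.FinalStateConjecture.FinalStateConjecture.Theorems.EIHFluxBalanceInertialRecessionStaircaseBalance
import Summits.FinalStateConjecture.FinalStateConjecture.Theorems.EIHFluxBalanceInertialRecessionStubSlaving12Reduction
import Summits.FinalStateConjecture.FinalStateConjecture.Theorems.EIHFluxBalanceInertialRecessionStubSlaving12RelRicciC3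
import Summits.FinalStateConjecture.FinalStateConjecture.Theorems.EIHFluxBalanceInertialRecessionStubMomRowLinear
import Summits.FinalStateConjecture.FinalStateConjecture.Theorems.EIHFluxBalanceInertialRecessionStubMomCapstone
import Summits.FinalStateConjecture.FinalStateConjecture.Theorems.EIHFluxBalanceInertialRecessionStubCoerMomQuant
import Summits.FinalStateConjecture.FinalStateConjecture.Theorems.EIHFluxBalanceInertialRecessionStubCoerSymbolQuant
import Summits.FinalStateConjecture.FinalStateConjecture.Theorems.EIHFluxBalanceInertialRecessionStubFirstOrderSlaving
import Summits.FinalStateConjecture.FinalStateConjecture.Theorems.EIHFluxBalanceInertialRecessionStubCoerMomKernelAssembly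
import Summits.FinalStateConjecture.FinalStateConjecture.Theorems.EIHFluxBalanceInertialRecessionStubHigherOrderSlaving

/-!
# CLOSING FILE (Theses-free; theorem type = the route decl body verbatim) of
# Line `SketchCleanExcision` (idea `clean-excision-has-a-rate`) — skeleton r13 (r12 + linear slaving re-cut) for the RESTATED crux
# `InertialRecession` (E′, item stmt-FinalStateConjecture-17403, route `EIHFluxBalance`)

Lead: `prover-line-stmt-FinalStateConjecture-17403-0` (gen 1, 2026-08-17). Card: `Cruxes/InertialRecession/Ideas/clean-excision-has-a-rate.md`;
sketch: `Cruxes/InertialRecession/SketchCleanExcision.lean`; predecessor skeleton (old decl, stmt-…-10166): r11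
`Cruxes/InertialRecession/Lines/sublinear_is_free_clean_window_charges.lean` (leads r2–r11), whose landed `--supports` material this
skeleton re-uses by name (pseudotensor bound p91215, window law p93132, identification p122003, oracle ⇒ velocities `…OracleTop`).

## What changed against r11 (E → E′, REPAIR rev 6)

The restated crux E′ APPENDS four clauses to the antecedent — (T) eventual lab-time causality on the guaranteed late region, (O) orthochronous
painted frames, (R) `RaysStayInClosure 𝒟 O` for the lab chart's own `O`, (QS) weighted quasi-stationarity of the painted background — and
concludes the re-typed summit clause (`… ∧ RaysStayInClosure 𝒟 O′ ∧ HasExhaustiveCharts d ∧ IsFutureOriented d`, honest radii). Hence: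
* r11's `stub_labChartCausalRigidity` ((T)+(O)) and `stub_weightedQuasiStationarity` (QS) are now HYPOTHESES — deleted;
* r11's `stub_rechart` is re-cut ON THE GIVEN REGION: `stub_rechartOnRegion` concludes `∃ d : FinalStateDecomposition 𝒟 O 2` on the lab
  chart's own `O` (with `O = exteriorOf 𝒟 d.charted`, honest-radii exhaustion and `IsFutureOriented d`), so (R) passes through the
  composition verbatim (design of the landed `Theorems.…StubRechart11Region.exists_finalStateDecomposition_onRegion_of_rechart`); it takes
  (T) and (O) as hypotheses (both in the antecedent now) and `0 < N`;
* `N = 0` is re-cut the same way: `stub_noHolesOnRegion` (the landed `Theorems.inertialRecession_noHoles` proves the OLD conclusion on the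
  smaller region `J⁺(ιX) ∩ I⁻(Φ{x⁰ > τ₀+1})`; on-region needs exhaustion at `τ₀ + 2` + push-up `J⁻(open) = I⁻(open)`, and orientation (iii) of
  the flat chart `Φ` from (T));
* THE LINE: r11's open Mathlib stub `stub_incrementOracle` (K2b; general member sets needed a re-partition count bounded in `N` because the
  identification slack `ζ` has no rate) is REPLACED by the clean-excision triple — `stub_cleanExcision` (GR: equal-time excision identity
  with a rate in SCALE, `|P(big window) − Σ P(sub-windows)| ≤ C·Rm^{-1/2}`, hypotheses verbatim those of the proved identification;
  corollary of the landed `LLGauss.perforatedGauss_law`, `shellGaussLaw_vacuum`, `abs_emComplex_le_of_pseudotensorBound`,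
  `ll_bulk_decay_bound`, `lab_sphereConditions`), `stub_integratedClusterBalance` (Mathlib: WINDOW LAW + IDENTIFICATION + (EXC) ⇒ the
  integrated cluster balance `‖Δ_{[t₁,t₂]} Σ_S Mγ(1,v)‖ ≤ ζ₀(t₁) + C₀∫ min(r,s)^{-3/2}` for EVERY member set `S` isolated by set-distance
  `r(s)` — staircase of static covers at a gap scale, re-covering paid by (EXC) as a Riemann sum of the flux integrand, identification paid
  only at the two ends) and `stub_oracleOfClusterBalance` (Mathlib: the r11 ORACLE(Q) conclusion verbatim from the cluster balance —
  ballistic outsiders give `r(s) ≥ max(A₀, (W/2)|s − s_{ij}|)`, the landed `integral_radius_le(_mixed)`; slowness of `S` unused);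
* `stub_slaving` (K1) is r11's, byte-identical.
Stubs: 7 declared; landed so far (cited without `sorry`): `stub_pseudotensorBound` (p91215), `stub_cleanExcision` (p134015),
`stub_oracleOfClusterBalance` (p134034), `stub_noHolesOnRegion` (p134159), `stub_rechartOnRegion` (p135865, + helpers …StubRechart12*),
`stub_integratedClusterBalance` (p136021; staircase parts …Staircase{Gap,Scales,Cover,Step,Facts,Main,Bound,Balance}); open: `stub_slaving` ONLY.
Composition `InertialRecession_of` concludes E′ BY NAME. The Theses-free closing file (route-decl body verbatim) is the lead's `work/Closing.template.lean`.

## r13 (lead c1-0, 2026-08-17): the slaving stub re-cut along the LINEAR architecture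
`stub_relRicciSlaving` (r12c) is retired (nonlinear gap at the first order); `stub_frozenVacuumSlaving` is PROVED from seven
registered stubs — ML `stub_momRowLinear` (Codazzi shadow: momentum rows linear in the normal first jet), A `stub_momCapstone`
(linear relative momentum bound from frozen-vacuum data), Bk `stub_coerMomKernel` (COER-mom kernel, all boosts and spins),
Bs `stub_coerMomQuant` (quantitative uniform robust COER-mom by compactness), C `stub_coerSymbolQuant` (quantitative COER-B
from the landed symbol/first-variation kernels), D `stub_firstOrderSlaving` (J¹ → 0 by linear absorption), EF
`stub_higherOrderSlaving` (J², J³ → 0, soft) — plus the landed `exists_relRicci_of_frozenVacuum`. Design memo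
`Cruxes/InertialRecession/Lines/SketchCleanExcision.md`.

## Disproof.lean obligations (gens 1–3, written against the old decl; re-read 2026-08-17)

§C/§G (`inertialRecession_false_without_fieldEquations[_cesaro]`): the field equations enter through `𝒟` in `stub_slaving`,
`stub_cleanExcision` (bulk `= (−g)t_LL` only where `Ric(Φ^*g) = 0`) and the landed window law / identification; the Mathlib stubs derive
nothing from kinematics alone (their charges are hypotheses the §C witness violates). §D/§H: exponent `3/2 > 1` at the SET-isolation
scale; no per-hole momentum below its isolation scale is claimed. `Negative/ExpandingChargeAdditivity` (additivity load-bearing): (EXC) is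
additivity made quantitative. `Negative/PaintingRigidityStabiliser`: no stub bounds `deriv Λᵢ`. No `-- Targets` theorem of Disproof.lean
names a stub of this skeleton (the file predates E′).
-/

set_option linter.dupNamespace false
set_option maxSynthPendingDepth 6
set_option synthInstance.maxHeartbeats 200000

noncomputable section

namespace Summit.FinalStateConjecture.FinalStateConjecture.Theorems.EIHFluxBalance.InertialRecessionR13

open scoped BigOperators Topology Manifold Classical MeasureTheory Matrix InnerProductSpace ContDiff ENNReal
open Filter Set Function TopologicalSpace MeasureTheory Literature.Geometry.Lorentzian

/-! ## The stubs (registered; every signature self-contained)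

Reshape r13 (lead c1-0, 2026-08-17): the r12c stub `stub_relRicciSlaving` (RRS) is RETIRED — its only
first-order information is the `λ²`-relative Ricci bound, which leaves the nonlinear gap
`c|J¹| ≤ Cε(1 + |J¹|²)` (seat 0 RRS_branch_note.md, seat 1 K1_RRS_vs_FVS_cut.md). FROZEN-VACUUM SLAVING
(`stub_frozenVacuumSlaving`, registered r12b, the hypothesis of the landed reduction
`stub_slaving_of_frozenVacuumSlaving`) is now PROVED below from seven registered stubs along the LINEAR
(momentum-constraint) architecture: the momentum rows `Ric(G)(♯_G dx⁰, e_j)` of any metric are the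
Codazzi/momentum constraint, exactly affine in the normal first jet (ML); so the rows of the modulated ansatz
are exactly linear in the first jet `J¹`, a linear relative bound (A: `|rows(g₀)| ≤ ε(1 + ‖Dg₀‖ + ‖D_sp Dg₀‖)`
from `Ric(g₀ + e) = 0`) and a linear injectivity (Bk/Bs: COER-mom, every boost and spin) give `J¹ → 0` by
linear absorption (D); then `J², J³ → 0` from the landed jet-relative `C²`/`C³` bound
(`exists_relRicci_of_frozenVacuum`) and the principal-symbol coercivity (C: symbol kernel + first-variation
kernel, both landed qualitatively) by Lipschitz bounds on compact jet sets (EF). Design memo: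
`Cruxes/InertialRecession/Lines/SketchCleanExcision.md` (r13). Objects (tree vocabulary only): one painted
summand with centre event `0`, `K = boostedKerrBilin L 0 M a`; an infinitesimal Poincaré motion of the REST
frame `(A, d)`, `A` `η`-skew (along a motion `A = (d/ds Λ⁻¹) ∘ Λ`, `d = −Λ⁻¹ ċ`); its lab first-variation field
`Var z = (∂_{Ay+d} g_{M,a})(y)(Λ⁻¹·,Λ⁻¹·) + g_{M,a}(y)(AΛ⁻¹·,Λ⁻¹·) + g_{M,a}(y)(Λ⁻¹·,AΛ⁻¹·)`, `y = Λ⁻¹z`; the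
first-order model `z ↦ G z + z⁰ • Var z` (same slice values, normal first jet shifted by `Var`); the reduced size
`‖A e₀‖ + ‖d⃗‖ + ‖a • A e₃‖` (the axial rotation rate and `d⁰` are the Kerr–Schild stabiliser). -/

/-- **FVS · FROZEN-VACUUM SLAVING** (registered r12b; since r13 PROVED from the seven stubs above — pure
logic plus the landed `C²`/`C³` capstone `exists_relRicci_of_frozenVacuum`, …StubSlaving12RelRicciC3).
Pure analysis on `E4`, no development, no chart: for every `N`, painted moduli with sub-extremal parameters and
`r₋ < rinᵢ < r₊`, Lorentz factors `≤ γ`, smooth motions and separating centres, and EVERY field `e` with (V)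
`e + g₀` vacuum metric components on every late hole-following tube with floor `≥ rinᵢ` and (S) `C³`-small on
the core-free late slabs, the third-order slaving block SLAVED³ holds. [folklore] -/
theorem stub_frozenVacuumSlaving :
    ∀ (N : ℕ) (M a rin : Fin N → ℝ) (Λ : Fin N → ℝ → lorentzGroup) (ξ : Fin N → ℝ → E3) (γ : ℝ) (e : E4 → E4 →L[ℝ] E4 →L[ℝ] ℝ), (∀ i, Kerr.IsSubextremal (M i) (a i) ∧ Kerr.rMinus (M i) (a i) < rin i ∧ rin i < Kerr.rPlus (M i) (a i)) → (∀ i t, |((Λ i t : E4 ≃L[ℝ] E4) (E4.basisVector 0)) 0| ≤ γ) → (∀ i, ContDiff ℝ ((⊤ : ℕ∞) : WithTop ℕ∞) (ξ i) ∧ ContDiff ℝ ((⊤ : ℕ∞) : WithTop ℕ∞) (fun t ↦ ((Λ i t : E4 ≃L[ℝ] E4) : E4 →L[ℝ] E4))) → (∀ i j, i ≠ j → Tendsto (fun t ↦ ‖ξ i t - ξ j t‖) atTop atTop) → (∀ (i : Fin N) (R r₀ : ℝ), rin i ≤ r₀ → ∃ T : ℝ, MetricCoord.IsMetricOn (fun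 z : E4 ↦ e z + (Minkowski.bilin + ∑ i, (boostedKerrBilin (Λ i (z 0)) (E4.ofTimeSpace (z 0) (ξ i (z 0))) (M i) (a i) z - Minkowski.bilin))) {x : E4 | T < x 0 ∧ ‖E4.spatial x - ξ i (x 0)‖ < R ∧ r₀ < Kerr.radius (a i) (poincareInv (Λ i (x 0)) (E4.ofTimeSpace (x 0) (ξ i (x 0))) x)} ∧ ∀ x : E4, T < x 0 → ‖E4.spatial x - ξ i (x 0)‖ < R → r₀ < Kerr.radius (a i) (poincareInv (Λ i (x 0)) (E4.ofTimeSpace (x 0) (ξ i (x 0))) x) → (∀ j, rin j < Kerr.radius (a j) (poincareInv (Λ j (x 0)) (E4.ofTimeSpace (x 0) (ξ j (x 0))) x)) ∧ MetricCoord.ricAt (fun z : E4 ↦ e z + (Minkowski.bilin + ∑ i, (boostedKerrBilin (Λ i (z 0)) (E4.ofTimeSpace (z 0) (ξ i (z 0))) (M i) (a i) z - Minkowski.bilin))) x = 0) → Tendsto (fun t : ℝ ↦ supCkENorm {x : E4 | x 0 = t ∧ ∀ j, rin j < Kerr.radius (a j) (poincareInv (Λ j (x 0)) (E4.ofTimeSpace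 (x 0) (ξ j (x 0))) x)} 3 e) atTop (𝓝 0) → (∀ i : Fin N, (∀ m : ℕ, 1 ≤ m → m ≤ 3 → Tendsto (fun t ↦ iteratedDeriv m (fun s ↦ (((Λ i s : lorentzGroup) : E4 ≃L[ℝ] E4) (E4.basisVector 0))) t) atTop (𝓝 0)) ∧ (∀ m : ℕ, m ≤ 2 → Tendsto (fun t ↦ iteratedDeriv m (fun s ↦ deriv (ξ i) s - (((((Λ i s : lorentzGroup) : E4 ≃L[ℝ] E4) (E4.basisVector 0)) 0)⁻¹ • E4.spatial (((Λ i s : lorentzGroup) : E4 ≃L[ℝ] E4) (E4.basisVector 0)))) t) atTop (𝓝 0)) ∧ (a i ≠ 0 → ∀ m : ℕ, 1 ≤ m → m ≤ 3 → Tendsto (fun t ↦ iteratedDeriv m (fun s ↦ (((Λ i s : lorentzGroup) : E4 ≃L[ℝ] E4) (E4.basisVector 3))) t) atTop (𝓝 0))) := by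
  intro N M a rin Λ ξ γ e h1 hγ hsm hsep hV hS
  have hγ1 : ∀ i : Fin N, (1 : ℝ) ≤ γ := fun i ↦
    (Summit.FinalStateConjecture.FinalStateConjecture.Theorems.one_le_abs_lorentz_apply_zero (Λ i 0)).trans (hγ i 0)
  have hML := Summit.FinalStateConjecture.FinalStateConjecture.Theorems.SublinearIsFree.Slaving.stub_momRowLinear
  have hM := Summit.FinalStateConjecture.FinalStateConjecture.Theorems.SublinearIsFree.Slaving.stub_momCapstone N M a rin Λ ξ γ e h1 hγ hsm hsep hV hS hML
  have hRR : (∀ (i : Fin N) (R r₀ : ℝ), rin i ≤ r₀ → ∀ ε : ℝ, 0 < ε → ∃ T : ℝ, ∀ x : E4, T < x 0 → ‖E4.spatial x - ξ i (x 0)‖ < R → r₀ < Kerr.radius (a i) (poincareInv (Λ i (x 0)) (E4.ofTimeSpace (x 0) (ξ i (x 0))) x) → ∀ l : ℝ, 1 ≤ l → ‖fderiv ℝ (fun z : E4 ↦ Minkowski.bilin + ∑ i, (boostedKerrBilin (Λ i (z 0)) (E4.ofTimeSpace (z 0) (ξ i (z 0))) (M i) (a i) z - Minkowski.bilin)) x‖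 ≤ l → ‖fderiv ℝ (fderiv ℝ (fun z : E4 ↦ Minkowski.bilin + ∑ i, (boostedKerrBilin (Λ i (z 0)) (E4.ofTimeSpace (z 0) (ξ i (z 0))) (M i) (a i) z - Minkowski.bilin))) x‖ ≤ l ^ 2 → ‖MetricCoord.ricAt (fun z : E4 ↦ Minkowski.bilin + ∑ i, (boostedKerrBilin (Λ i (z 0)) (E4.ofTimeSpace (z 0) (ξ i (z 0))) (M i) (a i) z - Minkowski.bilin)) x‖ ≤ ε * l ^ 2 ∧ (‖fderiv ℝ (fderiv ℝ (fderiv ℝ (fun z : E4 ↦ Minkowski.bilin + ∑ i, (boostedKerrBilin (Λ i (z 0)) (E4.ofTimeSpace (z 0) (ξ i (z 0))) (M i) (a i) z - Minkowski.bilin)))) x‖ ≤ l ^ 3 → ‖fderiv ℝ (MetricCoord.ricAt (fun z : E4 ↦ Minkowski.bilin + ∑ i, (boostedKerrBilin (Λ i (z 0)) (E4.ofTimeSpace (z 0) (ξ i (z 0))) (M i) (a i) z - Minkowski.bilin))) x‖ ≤ ε * l ^ 3)) := fun i R r₀ hr₀ ε hε ↦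
    Summit.FinalStateConjecture.FinalStateConjecture.Theorems.SublinearIsFree.Slaving.exists_relRicci_of_frozenVacuum
      h1 hγ hsm hsep hV hS i R r₀ hr₀ hε
  have hBs : ∀ i : Fin N, (∃ c ρin ρout η₀ : ℝ, 0 < c ∧ 0 < η₀ ∧ 0 < ρin ∧ ρin ≤ ρout ∧ (∀ (L : lorentzGroup) (y : E3), |((L : E4 ≃L[ℝ] E4) (E4.basisVector 0)) 0| ≤ γ → ρin ≤ ‖y‖ → 2 * (M i) < Kerr.radius (a i) (poincareInv L 0 (E4.ofTimeSpace 0 y))) ∧ ∀ (L : lorentzGroup) (A : E4 →L[ℝ] E4) (d : E4) (G : E4 → E4 →L[ℝ] E4 →L[ℝ] ℝ) (V : Set E4), |((L : E4 ≃L[ℝ] E4) (E4.basisVector 0)) 0| ≤ γ → (∀ u w : E4, Minkowski.bilin (A u) w + Minkowski.bilin u (A w) = 0) → MetricCoord.IsMetricOn G V → (∀ y : E3, ρin ≤ ‖y‖ → ‖y‖ ≤ ρout → (E4.ofTimeSpace 0 y) ∈ V ∧ ‖G (E4.ofTimeSpace 0 y) - boostedKerrBilin L 0 (M i) (a i) (E4.ofTimeSpace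 0 y)‖ ≤ η₀ ∧ ‖fderiv ℝ G (E4.ofTimeSpace 0 y) - fderiv ℝ (boostedKerrBilin L 0 (M i) (a i)) (E4.ofTimeSpace 0 y)‖ ≤ η₀ ∧ ‖fderiv ℝ (fderiv ℝ G) (E4.ofTimeSpace 0 y) - fderiv ℝ (fderiv ℝ (boostedKerrBilin L 0 (M i) (a i))) (E4.ofTimeSpace 0 y)‖ ≤ η₀) → ∃ y : E3, ρin ≤ ‖y‖ ∧ ‖y‖ ≤ ρout ∧ c * (‖A (E4.basisVector 0)‖ + ‖E4.spatial d‖ + ‖(a i) • A (E4.basisVector 3)‖) ≤ ∑ j : Fin 3, |MetricCoord.ricAt (fun z : E4 ↦ G z + (z 0) • ((fderiv ℝ (Kerr.bilin (M i) (a i)) (poincareInv L 0 z) (A (poincareInv L 0 z) + d)).bilinearComp (((L : E4 ≃L[ℝ] E4).symm : E4 →L[ℝ] E4)) (((L : E4 ≃L[ℝ] E4).symm : E4 →L[ℝ] E4)) + (Kerr.bilin (M i) (a i) (poincareInv L 0 z)).bilinearComp (A.comp (((L : E4 ≃L[ℝ] E4).symm : E4 →L[ℝ] E4))) (((L : E4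 ≃L[ℝ] E4).symm : E4 →L[ℝ] E4)) + (Kerr.bilin (M i) (a i) (poincareInv L 0 z)).bilinearComp (((L : E4 ≃L[ℝ] E4).symm : E4 →L[ℝ] E4)) (A.comp (((L : E4 ≃L[ℝ] E4).symm : E4 →L[ℝ] E4))))) (E4.ofTimeSpace 0 y) (MetricCoord.sharpAt G (E4.ofTimeSpace 0 y) (E4.dx 0)) (E4.basisVector j.succ) - MetricCoord.ricAt G (E4.ofTimeSpace 0 y) (MetricCoord.sharpAt G (E4.ofTimeSpace 0 y) (E4.dx 0)) (E4.basisVector j.succ)|) := fun i ↦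
    Summit.FinalStateConjecture.FinalStateConjecture.Theorems.SublinearIsFree.Slaving.stub_coerMomQuant (M i) (a i) γ (h1 i).1 (hγ1 i) hML Summit.FinalStateConjecture.FinalStateConjecture.Theorems.SublinearIsFree.Slaving.stub_coerMomKernel
  have hC : ∀ i : Fin N, (∃ c ρin ρout η₀ : ℝ, 0 < c ∧ 0 < η₀ ∧ 0 < ρin ∧ ρin ≤ ρout ∧ (∀ (L : lorentzGroup) (y : E3), |((L : E4 ≃L[ℝ] E4) (E4.basisVector 0)) 0| ≤ γ → ρin ≤ ‖y‖ → 2 * (M i) < Kerr.radius (a i) (poincareInv L 0 (E4.ofTimeSpace 0 y))) ∧ ∀ (L : lorentzGroup) (A : E4 →L[ℝ] E4) (d : E4) (G G' : E4 → E4 →L[ℝ] E4 →L[ℝ] ℝ) (V : Set E4), |((L : E4 ≃L[ℝ] E4) (E4.basisVector 0)) 0| ≤ γ → (∀ u w : E4, Minkowski.bilin (A u) w + Minkowski.bilin u (A w) = 0) → MetricCoord.IsMetricOn G V → MetricCoord.IsMetricOn G' V → (∀ y : E3, ρin ≤ ‖y‖ → ‖y‖ ≤ ρout → (E4.ofTimeSpace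 0 y) ∈ V ∧ ‖G (E4.ofTimeSpace 0 y) - boostedKerrBilin L 0 (M i) (a i) (E4.ofTimeSpace 0 y)‖ ≤ η₀ ∧ G' (E4.ofTimeSpace 0 y) = G (E4.ofTimeSpace 0 y) ∧ fderiv ℝ G' (E4.ofTimeSpace 0 y) = fderiv ℝ G (E4.ofTimeSpace 0 y) ∧ ∀ v : E4, fderiv ℝ (fderiv ℝ G') (E4.ofTimeSpace 0 y) v = fderiv ℝ (fderiv ℝ G) (E4.ofTimeSpace 0 y) v + (v 0) • (E4.dx 0).smulRight ((fderiv ℝ (Kerr.bilin (M i) (a i)) (poincareInv L 0 (E4.ofTimeSpace 0 y)) (A (poincareInv L 0 (E4.ofTimeSpace 0 y)) + d)).bilinearComp (((L : E4 ≃L[ℝ] E4).symm : E4 →L[ℝ] E4)) (((L : E4 ≃L[ℝ] E4).symm : E4 →L[ℝ] E4)) + (Kerr.bilin (M i) (a i) (poincareInv L 0 (E4.ofTimeSpace 0 y))).bilinearComp (A.comp (((L : E4 ≃L[ℝ] E4).symm : E4 →L[ℝ] E4))) (((L : E4 ≃L[ℝ] E4).symm : E4 →L[ℝ] E4)) + (Kerr.bilin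 (M i) (a i) (poincareInv L 0 (E4.ofTimeSpace 0 y))).bilinearComp (((L : E4 ≃L[ℝ] E4).symm : E4 →L[ℝ] E4)) (A.comp (((L : E4 ≃L[ℝ] E4).symm : E4 →L[ℝ] E4))))) → ∃ y : E3, ρin ≤ ‖y‖ ∧ ‖y‖ ≤ ρout ∧ c * (‖A (E4.basisVector 0)‖ + ‖E4.spatial d‖ + ‖(a i) • A (E4.basisVector 3)‖) ≤ ‖MetricCoord.ricAt G' (E4.ofTimeSpace 0 y) - MetricCoord.ricAt G (E4.ofTimeSpace 0 y)‖) := fun i ↦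
    Summit.FinalStateConjecture.FinalStateConjecture.Theorems.SublinearIsFree.Slaving.stub_coerSymbolQuant (M i) (a i) γ (h1 i).1 (hγ1 i)
  have hfirst := Summit.FinalStateConjecture.FinalStateConjecture.Theorems.SublinearIsFree.Slaving.stub_firstOrderSlaving N M a rin Λ ξ γ h1 hγ hsm hsep hML hBs hM
  have hhigh := Summit.FinalStateConjecture.FinalStateConjecture.Theorems.SublinearIsFree.Slaving.stub_higherOrderSlaving N M a rin Λ ξ γ h1 hγ hsm hsep hC hRR hfirst
  intro i
  obtain ⟨hu1, hm0, hn1⟩ := hfirst i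
  obtain ⟨⟨hu2, hu3⟩, ⟨hm1, hm2⟩, hn23⟩ := hhigh i
  refine ⟨fun m hm hm' ↦ ?_, fun m hm ↦ ?_, fun ha m hm hm' ↦ ?_⟩
  · interval_cases m <;> assumption
  · interval_cases m <;> assumption
  · obtain ⟨hn2, hn3⟩ := hn23 ha
    interval_cases m
    · exact hn1 ha
    · exact hn2
    · exact hn3

/-- **K1 · SLAVING, third order (modulo the Kerr–Schild stabiliser), plus painted-velocity kinematics** (r11 verbatim; since r12b a CITATION of w-slaving's reduction
`stub_slaving_of_frozenVacuumSlaving` applied to `stub_frozenVacuumSlaving`). Under the (old, twelve-clause) antecedent block, for every hole `i`: the painted 4-velocity `uᵢ(t) = Λᵢ(t)e₀` has lab-time derivatives of orders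
`1, 2, 3` tending to `0`; the centre mismatch `ξ̇ᵢ(t) − v(Λᵢ(t))`, `v(Λ) = (Λe₀)̲/(Λe₀)⁰`, and its first two derivatives tend to `0`; when
`aᵢ ≠ 0` the painted axis `Λᵢ(t)e₃` has derivatives of orders `1, 2, 3` tending to `0` (nothing about `deriv Λᵢ` itself —
`Negative/PaintingRigidityStabiliser`). Mechanism: `Ric(Φ^*g) = 0` and `C³`-closeness on whole lab slabs reaching inside the horizons give
`Ric(G(λ(·))) → 0` in `C¹` on each near annulus; tidal part `O(Mⱼ/Dᵢⱼ) → 0`; the remainder is linear in the parameter jet with explicit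
Kerr–Schild coefficient fields, injective modulo the Killing directions (COER: full rank verified in exact arithmetic), after an a-priori
bound on the jet from the `m ≤ 3` clauses. KINEMATICS: `t ↦ v(Λᵢ(t))` continuous and `‖v(Λᵢ(t))‖ ≤ k := √(1 − γ⁻²) < 1`. Landed parts:
`Theorems.…StubSlaving3ZeroSet` (F1, all spins), `…RicciNearHole`, jet-sharp Ricci perturbation, jet scaling, far field (a = 0), dilation;
remaining = COER + assembly. Size L/XL. [arXiv:0806.3293; LL §96; landed `Theorems.EIHFluxBalanceInertialRecessionLorentz`] -/
theorem stub_slaving : ∀ (X : Type) [TopologicalSpace X] [ChartedSpace E3 X] [IsManifold (𝓡 3) ((⊤ : ℕ∞) : WithTop ℕ∞) X] [T2Space X] [SecondCountableTopology X] [ConnectedSpace X], ∀ D ∈ admissibleVacuumData X, ∀ 𝒟 : VacuumCauchyDevelopment D, 𝒟.IsMaximal → ∀ (N : ℕ) (M a rin : Fin N → ℝ) (Λ : Fin N → ℝ → lorentzGroup) (ξ : Fin N → ℝ → E3) (γ κ τ₀ : ℝ) (U : Opens E4) (Φ : U → 𝒟.carrier) (O : Set 𝒟.carrier), ((∀ i,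 Kerr.IsSubextremal (M i) (a i) ∧ Kerr.rMinus (M i) (a i) < rin i ∧ rin i < Kerr.rPlus (M i) (a i)) ∧ (∀ i t, |((Λ i t : E4 ≃L[ℝ] E4) (E4.basisVector 0)) 0| ≤ γ) ∧ (∀ i, ContDiff ℝ ((⊤ : ℕ∞) : WithTop ℕ∞) (ξ i) ∧ ContDiff ℝ ((⊤ : ℕ∞) : WithTop ℕ∞) (fun t ↦ ((Λ i t : E4 ≃L[ℝ] E4) : E4 →L[ℝ] E4))) ∧ (∀ i j, i ≠ j → Tendsto (fun t ↦ ‖ξ i t - ξ j t‖) atTop atTop) ∧ (0 < κ ∧ κ < 1 ∧ ∀ i, ∀ᶠ t in atTop, ‖ξ i t‖ ≤ κ ^ 2 * t) ∧ ({x : E4 | τ₀ < x 0 ∧ ∀ i, rin i < Kerr.radius (a i) (poincareInv (Λ i (x 0)) (E4.ofTimeSpace (x 0) (ξ i (x 0))) x)} ⊆ (U : Set E4)) ∧ let B : ModelBackground := ⟨U, fun x ↦ Minkowski.bilin + ∑ i, (boostedKerrBilin (Λ i (x 0)) (E4.ofTimeSpace (x 0) (ξ i (x 0))) (M i) (a i)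 x - Minkowski.bilin), fun x ↦ x 0, E4.spatialNorm⟩; ContMDiff 𝓘(ℝ, E4) (𝓡 4) ((⊤ : ℕ∞) : WithTop ℕ∞) Φ ∧ Topology.IsOpenEmbedding ((B.lateRegion τ₀).restrict Φ) ∧ Φ '' {x : U | τ₀ < x.1 0 ∧ ∀ i, Kerr.rPlus (M i) (a i) < Kerr.radius (a i) (poincareInv (Λ i (x.1 0)) (E4.ofTimeSpace (x.1 0) (ξ i (x.1 0))) x.1)} ⊆ O ∧ Tendsto (fun t ↦ 𝒟.toSpacetime.deviationCk B Φ 3 t) atTop (𝓝 0) ∧ Tendsto (fun t : ℝ ↦ ⨆ x ∈ {x : U | x.1 0 = t ∧ E4.spatialNorm x.1 ≤ κ * t}, ⨆ (m : ℕ) (_ : m ≤ 3), ENNReal.ofReal (1 + √(√((⨅ i, ‖E4.spatial x.1 - ξ i t‖) ^ 7))) * ‖iteratedFDeriv ℝ m (𝒟.toSpacetime.deviationExtend B Φ) x.1‖ₑ) atTop (𝓝 0) ∧ O = Summit.FinalStateConjecture.exteriorOf 𝒟.toCauchyDevelopment (Φ '' {x : U | τ₀ < x.1 0 ∧ ∀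 i, Kerr.rPlus (M i) (a i) < Kerr.radius (a i) (poincareInv (Λ i (x.1 0)) (E4.ofTimeSpace (x.1 0) (ξ i (x.1 0))) x.1)}) ∧ ∀ t₁ : ℝ, τ₀ < t₁ → O \ Φ '' {x : U | t₁ < x.1 0 ∧ ∀ i, Kerr.rPlus (M i) (a i) < Kerr.radius (a i) (poincareInv (Λ i (x.1 0)) (E4.ofTimeSpace (x.1 0) (ξ i (x.1 0))) x.1)} ⊆ 𝒟.metric.causalPast 𝒟.timeOrientation (Φ '' {x : U | x.1 0 = t₁ ∧ ∀ i, Kerr.rPlus (M i) (a i) < Kerr.radius (a i) (poincareInv (Λ i (x.1 0)) (E4.ofTimeSpace (x.1 0) (ξ i (x.1 0))) x.1)})) →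
    (∀ i : Fin N, (∀ m : ℕ, 1 ≤ m → m ≤ 3 → Tendsto (fun t ↦ iteratedDeriv m (fun s ↦ (((Λ i s : lorentzGroup) : E4 ≃L[ℝ] E4) (E4.basisVector 0))) t) atTop (𝓝 0)) ∧ (∀ m : ℕ, m ≤ 2 → Tendsto (fun t ↦ iteratedDeriv m (fun s ↦ deriv (ξ i) s - (((((Λ i s : lorentzGroup) : E4 ≃L[ℝ] E4) (E4.basisVector 0)) 0)⁻¹ • E4.spatial (((Λ i s : lorentzGroup) : E4 ≃L[ℝ] E4) (E4.basisVector 0)))) t) atTop (𝓝 0)) ∧ (a i ≠ 0 → ∀ m : ℕ, 1 ≤ m → m ≤ 3 → Tendsto (fun t ↦ iteratedDeriv m (fun s ↦ (((Λ i s : lorentzGroup) : E4 ≃L[ℝ] E4) (E4.basisVector 3))) t) atTop (𝓝 0))) ∧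
    ((∀ i : Fin N, Continuous (fun t ↦ (((((Λ i t : lorentzGroup) : E4 ≃L[ℝ] E4) (E4.basisVector 0)) 0)⁻¹ • E4.spatial (((Λ i t : lorentzGroup) : E4 ≃L[ℝ] E4) (E4.basisVector 0))))) ∧ (∃ k : ℝ, 0 ≤ k ∧ k < 1 ∧ ∀ (i : Fin N) (t : ℝ), ‖(((((Λ i t : lorentzGroup) : E4 ≃L[ℝ] E4) (E4.basisVector 0)) 0)⁻¹ • E4.spatial (((Λ i t : lorentzGroup) : E4 ≃L[ℝ] E4) (E4.basisVector 0)))‖ ≤ k)) :=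
  Summit.FinalStateConjecture.FinalStateConjecture.Theorems.SublinearIsFree.Slaving.stub_slaving_of_frozenVacuumSlaving
    stub_frozenVacuumSlaving

/-! ## The composition (kernel-checked; concludes the crux BY NAME) -/

/-- **The crux `InertialRecession` (E′) of route `EIHFluxBalance` — closing theorem** (line `SketchCleanExcision`,
skeleton r13; the type is the body of `Summit.FinalStateConjecture.FinalStateConjecture.Theses.EIHFluxBalance.InertialRecession`
verbatim, so that this module does not import the route file). For every admissible datum and MGHD: modulated
multi-Kerr–Schild asymptotics in a lab chart (with the handoff clauses (T), (O), (R), (QS)) imply settling to a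
`FinalStateDecomposition` on the same region with sub-extremal holes, honest-radii exhaustion and future orientation.
Composition: `N = 0` is `stub_noHolesOnRegion`; for `0 < N`: frozen-vacuum slaving (`stub_slaving`, via the linear
momentum-constraint architecture ML/A/Bk/Bs/C/D/EF) ⇒ pseudotensor bound ⇒ window law + identification + clean
excision ⇒ integrated cluster balance ⇒ increment oracle ⇒ convergent painted velocities ⇒ re-charting on the
given region; (R) passes through. [folklore] -/
theorem inertialRecession_proof :
    open Literature.Geometry.Lorentzian in ∀ (X : Type) [TopologicalSpace X] [ChartedSpace E3 X] [IsManifold (𝓡 3) ((⊤ : ℕ∞) : WithTop ℕ∞) X] [T2Space X] [SecondCountableTopology X] [ConnectedSpace X], ∀ D ∈ admissibleVacuumData X, ∀ 𝒟 : VacuumCauchyDevelopment D, 𝒟.IsMaximal → (∃ (N : ℕ) (M a rin : Fin N → ℝ) (Λ : Fin N → ℝ → lorentzGroup) (ξ : Fin N → ℝ → E3) (γ κ τ₀ : ℝ) (U : Opens E4) (Φ : U → 𝒟.carrier) (O : Set 𝒟.carrier), (∀ i, Kerr.IsSubextremal (M i) (a i) ∧ Kerr.rMinus (M i) (a i) <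 rin i ∧ rin i < Kerr.rPlus (M i) (a i)) ∧ (∀ i t, |((Λ i t : E4 ≃L[ℝ] E4) (E4.basisVector 0)) 0| ≤ γ) ∧ (∀ i, ContDiff ℝ ((⊤ : ℕ∞) : WithTop ℕ∞) (ξ i) ∧ ContDiff ℝ ((⊤ : ℕ∞) : WithTop ℕ∞) (fun t ↦ ((Λ i t : E4 ≃L[ℝ] E4) : E4 →L[ℝ] E4))) ∧ (∀ i j, i ≠ j → Tendsto (fun t ↦ ‖ξ i t - ξ j t‖) atTop atTop) ∧ (0 < κ ∧ κ < 1 ∧ ∀ i, ∀ᶠ t in atTop, ‖ξ i t‖ ≤ κ ^ 2 * t) ∧ ({x : E4 | τ₀ < x 0 ∧ ∀ i, rin i < Kerr.radius (a i) (poincareInv (Λ i (x 0)) (E4.ofTimeSpace (x 0) (ξ i (x 0))) x)} ⊆ (U : Set E4)) ∧ let B : ModelBackground := ⟨U, fun x ↦ Minkowski.bilin + ∑ i, (boostedKerrBilin (Λ i (x 0)) (E4.ofTimeSpace (x 0) (ξ i (x 0))) (M i) (a i) x - Minkowski.bilin), fun x ↦ x 0, E4.spatialNorm⟩; ContMDiff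 𝓘(ℝ, E4) (𝓡 4) ((⊤ : ℕ∞) : WithTop ℕ∞) Φ ∧ Topology.IsOpenEmbedding ((B.lateRegion τ₀).restrict Φ) ∧ Φ '' {x : U | τ₀ < x.1 0 ∧ ∀ i, Kerr.rPlus (M i) (a i) < Kerr.radius (a i) (poincareInv (Λ i (x.1 0)) (E4.ofTimeSpace (x.1 0) (ξ i (x.1 0))) x.1)} ⊆ O ∧ Tendsto (fun t ↦ 𝒟.toSpacetime.deviationCk B Φ 3 t) atTop (𝓝 0) ∧ Tendsto (fun t : ℝ ↦ ⨆ x ∈ {x : U | x.1 0 = t ∧ E4.spatialNorm x.1 ≤ κ * t}, ⨆ (m : ℕ) (_ : m ≤ 3), ENNReal.ofReal (1 + √(√((⨅ i, ‖E4.spatial x.1 - ξ i t‖) ^ 7))) * ‖iteratedFDeriv ℝ m (𝒟.toSpacetime.deviationExtend B Φ) x.1‖ₑ) atTop (𝓝 0) ∧ O = Summit.FinalStateConjecture.exteriorOf 𝒟.toCauchyDevelopment (Φ '' {x : U | τ₀ < x.1 0 ∧ ∀ i, Kerr.rPlus (M i) (a i) < Kerr.radius (a i) (poincareInv (Λ i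 (x.1 0)) (E4.ofTimeSpace (x.1 0) (ξ i (x.1 0))) x.1)}) ∧ (∀ t₁ : ℝ, τ₀ < t₁ → O \ Φ '' {x : U | t₁ < x.1 0 ∧ ∀ i, Kerr.rPlus (M i) (a i) < Kerr.radius (a i) (poincareInv (Λ i (x.1 0)) (E4.ofTimeSpace (x.1 0) (ξ i (x.1 0))) x.1)} ⊆ 𝒟.metric.causalPast 𝒟.timeOrientation (Φ '' {x : U | x.1 0 = t₁ ∧ ∀ i, Kerr.rPlus (M i) (a i) < Kerr.radius (a i) (poincareInv (Λ i (x.1 0)) (E4.ofTimeSpace (x.1 0) (ξ i (x.1 0))) x.1)})) ∧ (∃ τ₁ : ℝ, ∀ x y : U, (τ₁ < x.1 0 ∧ ∀ i, rin i < Kerr.radius (a i) (poincareInv (Λ i (x.1 0)) (E4.ofTimeSpace (x.1 0) (ξ i (x.1 0))) x.1)) → (τ₁ < y.1 0 ∧ ∀ i, rin i < Kerr.radius (a i) (poincareInv (Λ i (y.1 0)) (E4.ofTimeSpace (y.1 0) (ξ i (y.1 0))) y.1)) → Φ y ∈ 𝒟.metric.causalFuture 𝒟.timeOrientation {Φ x}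 → x.1 0 ≤ y.1 0) ∧ (∀ (i : Fin N) (t : ℝ), 0 < (((Λ i t : lorentzGroup) : E4 ≃L[ℝ] E4) (E4.basisVector 0)) 0) ∧ Summit.FinalStateConjecture.RaysStayInClosure 𝒟.toCauchyDevelopment O ∧ (∀ ρ : ℝ → ℝ, Tendsto ρ atTop atTop → Tendsto (fun t : ℝ ↦ ⨆ x ∈ {x : E4 | x 0 = t ∧ E4.spatialNorm x ≤ κ * t ∧ ρ t ≤ ⨅ i, ‖E4.spatial x - ξ i t‖}, ENNReal.ofReal (1 + √(√((⨅ i, ‖E4.spatial x - ξ i t‖) ^ 7))) * ‖fderiv ℝ (fun y : E4 ↦ Minkowski.bilin + ∑ i, (boostedKerrBilin (Λ i (y 0)) (E4.ofTimeSpace (y 0) (ξ i (y 0))) (M i) (a i) y - Minkowski.bilin)) x (E4.basisVector 0)‖ₑ) atTop (𝓝 0))) → ∃ (O : Set 𝒟.carrier) (d : FinalStateDecomposition 𝒟.toSpacetime O 2), (∀ i, Kerr.IsSubextremal (d.mass i) (d.spin i)) ∧ O = Summit.FinalStateConjecture.exteriorOf 𝒟.toCauchyDevelopment d.charted ∧ Summit.FinalStateConjecture.RaysStayInClosure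 𝒟.toCauchyDevelopment O ∧ Summit.FinalStateConjecture.HasExhaustiveCharts d ∧ Summit.FinalStateConjecture.IsFutureOriented d := by
  intro X _ _ _ _ _ _ D hD 𝒟 h𝒟 hyp
  obtain ⟨N, M, a, rin, Λ, ξ, γ, κ, τ₀, U, Φ, O, h1, h2, h3, h4, h5, h6, hB⟩ := hyp
  obtain ⟨h7, h8, h9, h10, h11, h12, h13, hT, hO, hR, hQS⟩ := hB
  have hL : ((∀ i, Kerr.IsSubextremal (M i) (a i) ∧ Kerr.rMinus (M i) (a i) < rin i ∧ rin i < Kerr.rPlus (M i) (a i)) ∧ (∀ i t, |((Λ i t : E4 ≃L[ℝ] E4) (E4.basisVector 0)) 0| ≤ γ) ∧ (∀ i, ContDiff ℝ ((⊤ : ℕ∞) : WithTop ℕ∞) (ξ i) ∧ ContDiff ℝ ((⊤ : ℕ∞) : WithTop ℕ∞) (fun t ↦ ((Λ i t : E4 ≃L[ℝ] E4) : E4 →L[ℝ] E4))) ∧ (∀ i j, i ≠ j → Tendsto (fun t ↦ ‖ξ i t - ξ j t‖) atTop atTop) ∧ (0 < κ ∧ κ < 1 ∧ ∀ i, ∀ᶠ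 t in atTop, ‖ξ i t‖ ≤ κ ^ 2 * t) ∧ ({x : E4 | τ₀ < x 0 ∧ ∀ i, rin i < Kerr.radius (a i) (poincareInv (Λ i (x 0)) (E4.ofTimeSpace (x 0) (ξ i (x 0))) x)} ⊆ (U : Set E4)) ∧ let B : ModelBackground := ⟨U, fun x ↦ Minkowski.bilin + ∑ i, (boostedKerrBilin (Λ i (x 0)) (E4.ofTimeSpace (x 0) (ξ i (x 0))) (M i) (a i) x - Minkowski.bilin), fun x ↦ x 0, E4.spatialNorm⟩; ContMDiff 𝓘(ℝ, E4) (𝓡 4) ((⊤ : ℕ∞) : WithTop ℕ∞) Φ ∧ Topology.IsOpenEmbedding ((B.lateRegion τ₀).restrict Φ) ∧ Φ '' {x : U | τ₀ < x.1 0 ∧ ∀ i, Kerr.rPlus (M i) (a i) < Kerr.radius (a i) (poincareInv (Λ i (x.1 0)) (E4.ofTimeSpace (x.1 0) (ξ i (x.1 0))) x.1)} ⊆ O ∧ Tendsto (fun t ↦ 𝒟.toSpacetime.deviationCk B Φ 3 t) atTop (𝓝 0) ∧ Tendsto (fun t : ℝ ↦ ⨆ x ∈ {x : U | x.1 0 =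 t ∧ E4.spatialNorm x.1 ≤ κ * t}, ⨆ (m : ℕ) (_ : m ≤ 3), ENNReal.ofReal (1 + √(√((⨅ i, ‖E4.spatial x.1 - ξ i t‖) ^ 7))) * ‖iteratedFDeriv ℝ m (𝒟.toSpacetime.deviationExtend B Φ) x.1‖ₑ) atTop (𝓝 0) ∧ O = Summit.FinalStateConjecture.exteriorOf 𝒟.toCauchyDevelopment (Φ '' {x : U | τ₀ < x.1 0 ∧ ∀ i, Kerr.rPlus (M i) (a i) < Kerr.radius (a i) (poincareInv (Λ i (x.1 0)) (E4.ofTimeSpace (x.1 0) (ξ i (x.1 0))) x.1)}) ∧ ∀ t₁ : ℝ, τ₀ < t₁ → O \ Φ '' {x : U | t₁ < x.1 0 ∧ ∀ i, Kerr.rPlus (M i) (a i) < Kerr.radius (a i) (poincareInv (Λ i (x.1 0)) (E4.ofTimeSpace (x.1 0) (ξ i (x.1 0))) x.1)} ⊆ 𝒟.metric.causalPast 𝒟.timeOrientation (Φ '' {x : U | x.1 0 = t₁ ∧ ∀ i, Kerr.rPlus (M i) (a i) < Kerr.radius (a i) (poincareInv (Λ i (x.1 0)) (E4.ofTimeSpace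 (x.1 0) (ξ i (x.1 0))) x.1)})) :=
    ⟨h1, h2, h3, h4, h5, h6, h7, h8, h9, h10, h11, h12, h13⟩
  -- no hole: the dispersive case on the given region
  rcases Nat.eq_zero_or_pos N with hN0 | hN
  · obtain ⟨d, hsub, hOe, hexh, hfo⟩ := Summit.FinalStateConjecture.FinalStateConjecture.Theorems.SketchCleanExcision.stub_noHolesOnRegion X D hD 𝒟 h𝒟 N M a rin Λ ξ γ κ τ₀ U Φ O hL hN0 hT
    exact ⟨O, d, hsub, hOe, hR, hexh, hfo⟩
  obtain ⟨hS, hcont, hk⟩ := stub_slaving X D hD 𝒟 h𝒟 N M a rin Λ ξ γ κ τ₀ U Φ O hL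
  have hW := Summit.FinalStateConjecture.FinalStateConjecture.Theorems.SublinearIsFree.ChargeModel.windowLaw Summit.FinalStateConjecture.FinalStateConjecture.Theorems.SublinearIsFree.PseudotensorBound.stub_pseudotensorBound
    X D hD 𝒟 h𝒟 N M a rin Λ ξ γ κ τ₀ U Φ O hL hN hS hQS
  have hI := Summit.FinalStateConjecture.FinalStateConjecture.Theorems.SublinearIsFree.ChargeModel.cleanWindowCharges_identification
    Summit.FinalStateConjecture.FinalStateConjecture.Theorems.SublinearIsFree.PseudotensorBound.stub_pseudotensorBound X D hD 𝒟 h𝒟 N M a rin Λ ξ γ κ τ₀ U Φ O hL hN hS hQS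
  have hE := Summit.FinalStateConjecture.FinalStateConjecture.Theorems.SketchCleanExcision.stub_cleanExcision Summit.FinalStateConjecture.FinalStateConjecture.Theorems.SublinearIsFree.PseudotensorBound.stub_pseudotensorBound X D hD 𝒟 h𝒟 N M a rin Λ ξ γ κ τ₀ U Φ O hL hN hS hQS
  -- kinematic clauses of the antecedent consumed by the endgame
  have hM : ∀ i, 0 < M i := fun i ↦ (abs_nonneg (a i)).trans_lt (hL.1 i).1
  have hκ : 0 < κ ∧ κ < 1 ∧ ∀ i, ∀ᶠ t in atTop, ‖ξ i t‖ ≤ κ ^ 2 * t := hL.2.2.2.2.1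
  have hsep : ∀ i j, i ≠ j → Tendsto (fun t ↦ ‖ξ i t - ξ j t‖) atTop atTop := hL.2.2.2.1
  have hsmooth : ∀ i, ContDiff ℝ ((⊤ : ℕ∞) : WithTop ℕ∞) (ξ i) := fun i ↦ (hL.2.2.1 i).1
  have hmis : ∀ i, Tendsto (fun t ↦ deriv (ξ i) t -
      ((((Λ i t : lorentzGroup) : E4 ≃L[ℝ] E4) (E4.basisVector 0)) 0)⁻¹ •
        E4.spatial (((Λ i t : lorentzGroup) : E4 ≃L[ℝ] E4) (E4.basisVector 0))) atTop (𝓝 0) := fun i ↦ by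
    simpa using (hS i).2.1 0 (Nat.zero_le 2)
  obtain ⟨k, hk0, hk1, hkb⟩ := hk
  have hCB := Summit.FinalStateConjecture.FinalStateConjecture.Theorems.SublinearIsFree.Staircase.stub_integratedClusterBalance N M ξ _ κ _ hM hκ.1 hκ.2.1 hsmooth hκ.2.2 hsep hcont
    ⟨k, hk0, hk1, fun i t ↦ hkb i t⟩ hmis hW hI hE
  obtain ⟨Q, hQ400, hOR⟩ := Summit.FinalStateConjecture.FinalStateConjecture.Theorems.SublinearIsFree.Oracle.stub_oracleOfClusterBalance N M ξ _ κ hM hκ.1 hκ.2.1 hsmooth hκ.2.2 hsep hcont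
    ⟨k, hk0, hk1, fun i t ↦ hkb i t⟩ hmis hCB
  -- every painted velocity converges (the abstract endgame modulo the oracle, every `N`)
  have hv := Summit.FinalStateConjecture.FinalStateConjecture.Theorems.SublinearIsFree.Oracle.tendsto_velocity_of_oracle M ξ _ Q hM hQ400
    hcont ⟨k, hk0, hk1, fun i t ↦ hkb i t⟩ hmis hOR
  obtain ⟨d, hsub, hOe, hexh, hfo⟩ := Summit.FinalStateConjecture.FinalStateConjecture.Theorems.stub_rechartOnRegion X D hD 𝒟 h𝒟 N M a rin Λ ξ γ κ τ₀ U Φ O hL hN hS hv hT hO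
  exact ⟨O, d, hsub, hOe, hR, hexh, hfo⟩

end Summit.FinalStateConjecture.FinalStateConjecture.Theorems.EIHFluxBalance.InertialRecessionR13

end
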